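import Summits.AtomisticToContinuum.BoseEinsteinCondensation.Theses.BECLiebAntibunching
import Literature.MathematicalPhysics.QuantumManyBody.PeriodicFeynmanKacCell
import Literature.MathematicalPhysics.QuantumManyBody.WeightedCorrector
import Literature.MathematicalPhysics.QuantumManyBody.BoseGasDirichletWall
import HarnessLib.Audit

/-!
# Crux `NonPairwisePalmMean` (stmt-AtomisticToContinuum-10240) — birth skeleton (BC3), line `birth`

Route `BECLiebAntibunching` (rank-3 crux): for every bounded repulsive finite-range `v`, all small
`ρ`, some `U₀, C`, all large `N = n+2` (`L = (N/ρ)^{1/3}`), there is a continuous bounded even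
`Lℤ³`-periodic profile `u` such that every positive translation-invariant periodic ground state `Ψ`
has `∫_{cell^{n+1}} |Ψ(x,Y)|² [log(|Ψ(x,Y)|/|Ψ(y,Y)|) − Σ_j (u(y−Y_j) − u(x−Y_j))] dY ≤ C ∫ |Ψ(x,Y)|² dY`
for all `x, y` (Palm mean of the increment of the non-pairwise landscape `R = −log Ψ − Σ_j u(·−Y_j)`).

## The line: BARE-LANDSCAPE CHAINING (`u := 0`)

The profile `u` is free in the crux; the line takes `u ≡ 0` (the refuters' reading of the item:
`½·KL(P_x ‖ P_y) ≤ C` for the Palm laws `P_x ∝ |Ψ(x,·)|²` of the exact ground state — by the route's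
own hole-control bookkeeping any bounded `u` moves the Palm mean by `≤ 4U₀C_A`, so given rank 2
nothing is lost) and introduces a LOCAL object: the Palm-conditioned landscape increment
`I_x(z, z') = E_{P_x}[log|Ψ(z,·)| − log|Ψ(z',·)|]` between two GHOST positions `z, z'` of the tagged
particle while the bath stays conditioned on the particle sitting at `x`.  Since
`log(|Ψ(x,Y)|/|Ψ(y,Y)|) = Σ_i log(|Ψ(z_i,Y)|/|Ψ(z_{i+1},Y)|)` along any chain `x = z_0, …, z_m = y`,
the crux quantity is `Σ_i I_x(z_i, z_{i+1})`: walk from `x` to the nearest lattice image `y'` of `y`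
in steps of length `≤ ℓ`.  Two mechanisms, two stubs:

* `stub_palmLogHarnack` — NEAR FIELD (local regularity of the positive ground state under Palm
  conditioning; a Palm/log-Harnack inequality in ONE particle coordinate): for every `ℓ > 0` there is
  `A` with `I_x(z, z') ≤ A` whenever `‖z − x‖ ≤ ℓ`, `‖z' − z‖ ≤ ℓ`, uniformly in large `N`, ground states
  `Ψ` and `x`.  (At `z = x` this is the crux at teleport distance `≤ ℓ`; the 2-body part contributes
  `ρ∫(u₂(z'−a) − u₂(z−a)) h(x−a) da = O(1)` by the exact cancellation against the constant density.)
* `stub_influenceDecay` — FAR FIELD (decay of the influence of the pinned particle on remote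
  landscape increments = clustering of the ground state as seen by the landscape): some scale `ℓ > 0`,
  an envelope `ω` antitone on `[ℓ, ∞)` with bounded partial sums `Σ_{i<m} ω((i+2)ℓ/2) ≤ B`, such that
  `I_x(z, z') ≤ ω(‖z − x‖)` whenever `ℓ ≤ ‖z − x‖`, `z − x` lies in the closed half-cube
  `|(z−x)_k| ≤ L/2` (nearest-image proviso — near an image of `x` the increment is large again) and
  `‖z' − z‖ ≤ ℓ`.  Bogoliubov/Jastrow heuristics give `ω(r) = O(ℓ r⁻³)` (perfectly screened
  Reatto–Chester tail, `h ∼ r⁻⁴`); the crux's acknowledged danger — a `log L` drift from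
  3-body/backflow structure — is exactly `ω(r) ∼ r⁻¹` here, i.e. failure of summability.  This stub
  carries the infrared content; the near stub is local.

`NonPairwisePalmMean_of` is the sorry-free composition (hypotheses BY NAME: the `Goal.stub_*`
statement abbrevs, whose bodies are the stub signatures verbatim — `NonPairwisePalmMean_of_stubs`
type-checks that): `u := 0`, `U₀ := 0`, `ρ₀ := min`, `C := 2·max(A,0) + max(B,0)`; for a ground state
and `x, y`: nearest-image reduction `y ↦ y' = y + Lm` with `|(y'−x)_k| ≤ L/2` (`exists_recenter`,
coordinates rounded; periodicity of `Ψ` in the tagged particle under the whole lattice,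
`psi_vecCons_add_latticeVec` via `apply_add_latticeVecN_of_periodic`), then the CHAINING ESTIMATE
`chain_bound`: `z_i = x + (i/m)(y'−x)`, `m = max(1, ⌈‖y'−x‖/ℓ⌉)`, step `s = ‖y'−x‖/m ∈ (ℓ/2, ℓ]` once
`m ≥ 2`; pointwise telescoping of `log` (positivity of `Ψ`), linearity of the Bochner integral over
the finite sum (continuity ⇒ `integrableOn_cellN`), steps `i = 0, 1` by the near stub, steps `i ≥ 2`
by the far stub with `ω(i s) ≤ ω(iℓ/2)` (antitone) and the partial-sum bound.  ~150 lines, axioms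
`{propext, Classical.choice, Quot.sound}`; `lean check` rc 0, sorries 2 = stubs 2.

Disproof used: none on file for this crux (`ledger crux ls stmt-AtomisticToContinuum-10240`: no
workfiles, no `Disproof.lean`, 2026-08-17); no landed `Theorems/NonPairwisePalmMean/Negative/*`;
`ledger negatives`: nothing on this decl (route header: only the SwapJensen sign slip on this summit's
Palm family — no stub here quantifies a real constant universally: `∃ A`, `∃ ℓ ω B`, and `∀ᶠ n`).
BC3 probes (planner folder `bc/NonPairwisePalmMean_probes.lean`, imports Statement + route file only;
4 examples `X → NonPairwisePalmMean` / `X → _root_.BoseEinsteinCondensation` by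
`first | exact? | simpa | aesop`): ALL FAIL (4/4: unsolved goals; aesop "failed to prove the goal after
exhaustive search"; no timeout, wall 73 s).
-/

namespace Summit.AtomisticToContinuum.BoseEinsteinCondensation.Cruxes.NonPairwisePalmMean.Birth

open MeasureTheory Filter
open scoped ENNReal NNReal BigOperators
open Literature.MathematicalPhysics.QuantumManyBody.BoseGas

/-! ### Statements of the stubs BY NAME (audit names; bodies = the stub signatures verbatim) -/

namespace Goal

/-- Statement of `stub_palmLogHarnack` (near field). -/
abbrev stub_palmLogHarnack : Prop :=
  open Literature.MathematicalPhysics.QuantumManyBody.BoseGas in ∀ v : ℝ → ENNReal, IsRepulsiveFiniteRange v → (∃ M : NNReal, ∀ r, v r ≤ M) → ∃ ρ₀ : ℝ, 0 < ρ₀ ∧ ∀ ρ : ℝ, 0 < ρ → ρ < ρ₀ → ∀ ℓ : ℝ, 0 < ℓ → ∃ A : ℝ, ∀ᶠ n : ℕ in Filter.atTop, ∀ Ψ : PeriodicTrialState (n + 2) (sideLength ρ (n + 2)), periodicEnergy v Ψ = periodicGroundStateEnergy v (n + 2) (sideLength ρ (n + 2)) → (∀ X, 0 < (Ψ.ψ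 X).re ∧ (Ψ.ψ X).im = 0) → (∀ (X : Config (n + 2)) (t : Space), Ψ.ψ (fun i => X i + t) = Ψ.ψ X) → ∀ x z z' : Space, ‖z - x‖ ≤ ℓ → ‖z' - z‖ ≤ ℓ → ∫ Y in cellN (n + 1) (sideLength ρ (n + 2)), ‖Ψ.ψ (Matrix.vecCons x Y)‖ ^ 2 * Real.log (‖Ψ.ψ (Matrix.vecCons z Y)‖ / ‖Ψ.ψ (Matrix.vecCons z' Y)‖) ≤ A * ∫ Y in cellN (n + 1) (sideLength ρ (n + 2)), ‖Ψ.ψ (Matrix.vecCons x Y)‖ ^ 2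

/-- Statement of `stub_influenceDecay` (far field). -/
abbrev stub_influenceDecay : Prop :=
  open Literature.MathematicalPhysics.QuantumManyBody.BoseGas in ∀ v : ℝ → ENNReal, IsRepulsiveFiniteRange v → (∃ M : NNReal, ∀ r, v r ≤ M) → ∃ ρ₀ : ℝ, 0 < ρ₀ ∧ ∀ ρ : ℝ, 0 < ρ → ρ < ρ₀ → ∃ ℓ : ℝ, 0 < ℓ ∧ ∃ ω : ℝ → ℝ, AntitoneOn ω (Set.Ici ℓ) ∧ ∃ B : ℝ, (∀ m : ℕ, ∑ i ∈ Finset.range m, ω ((i + 2) * ℓ / 2) ≤ B) ∧ ∀ᶠ n : ℕ in Filter.atTop, ∀ Ψ : PeriodicTrialState (n + 2) (sideLength ρ (n + 2)), periodicEnergy v Ψ = periodicGroundStateEnergy v (n + 2) (sideLength ρ (n + 2)) → (∀ X, 0 < (Ψ.ψ X).re ∧ (Ψ.ψ X).im = 0) → (∀ (X : Config (n + 2)) (t : Space), Ψ.ψ (fun i => X i + t) = Ψ.ψ X) → ∀ x z z' : Space, ℓ ≤ ‖z - x‖ → (∀ k : Fin 3, |(z - x) k| ≤ sideLength ρ (n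 + 2) / 2) → ‖z' - z‖ ≤ ℓ → ∫ Y in cellN (n + 1) (sideLength ρ (n + 2)), ‖Ψ.ψ (Matrix.vecCons x Y)‖ ^ 2 * Real.log (‖Ψ.ψ (Matrix.vecCons z Y)‖ / ‖Ψ.ψ (Matrix.vecCons z' Y)‖) ≤ ω ‖z - x‖ * ∫ Y in cellN (n + 1) (sideLength ρ (n + 2)), ‖Ψ.ψ (Matrix.vecCons x Y)‖ ^ 2

end Goal

/-! ### Registered stubs (the only `sorry`s of this file) -/

/-- **Stub 1 (near field: Palm log-Harnack in the tagged coordinate).** For every bounded repulsive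
finite-range `v` there is `ρ₀ > 0` such that for `0 < ρ < ρ₀` and every `ℓ > 0` there is `A` with, for
all large `N = n+2`, every positive translation-invariant periodic ground state `Ψ` on the torus of side
`L = (N/ρ)^{1/3}` and all `x, z, z'` with `‖z − x‖ ≤ ℓ`, `‖z' − z‖ ≤ ℓ`:
`∫_{cell^{n+1}} |Ψ(x,Y)|² log(|Ψ(z,Y)|/|Ψ(z',Y)|) dY ≤ A ∫_{cell^{n+1}} |Ψ(x,Y)|² dY`
(`E_{P_x}[log|Ψ(z,·)| − log|Ψ(z',·)|] ≤ A`: moving a ghost of the tagged particle by `≤ ℓ` within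
distance `ℓ` of the pinned position costs `O(1)` on Palm average, uniformly in `N`). -/
theorem stub_palmLogHarnack : open Literature.MathematicalPhysics.QuantumManyBody.BoseGas in ∀ v : ℝ → ENNReal, IsRepulsiveFiniteRange v → (∃ M : NNReal, ∀ r, v r ≤ M) → ∃ ρ₀ : ℝ, 0 < ρ₀ ∧ ∀ ρ : ℝ, 0 < ρ → ρ < ρ₀ → ∀ ℓ : ℝ, 0 < ℓ → ∃ A : ℝ, ∀ᶠ n : ℕ in Filter.atTop, ∀ Ψ : PeriodicTrialState (n + 2) (sideLength ρ (n + 2)), periodicEnergy v Ψ = periodicGroundStateEnergy v (n + 2) (sideLength ρ (n + 2)) → (∀ X, 0 < (Ψ.ψ X).re ∧ (Ψ.ψ X).im = 0) → (∀ (X : Config (n + 2)) (t : Space), Ψ.ψ (fun i => X i + t) = Ψ.ψ X) → ∀ x z z' : Space, ‖z - x‖ ≤ ℓ → ‖z' - z‖ ≤ ℓ → ∫ Y in cellN (n + 1) (sideLength ρ (n + 2)), ‖Ψ.ψ (Matrix.vecCons x Y)‖ ^ 2 * Real.log (‖Ψ.ψ (Matrix.vecCons z Y)‖ / ‖Ψ.ψ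 (Matrix.vecCons z' Y)‖) ≤ A * ∫ Y in cellN (n + 1) (sideLength ρ (n + 2)), ‖Ψ.ψ (Matrix.vecCons x Y)‖ ^ 2 := by
  sorry

/-- **Stub 2 (far field: summable decay of the pinned particle's influence on remote landscape
increments).** For every bounded repulsive finite-range `v` there is `ρ₀ > 0` such that for
`0 < ρ < ρ₀` there are a scale `ℓ > 0`, an envelope `ω : ℝ → ℝ` antitone on `[ℓ, ∞)` with bounded
partial sums `Σ_{i<m} ω((i+2)ℓ/2) ≤ B` (all `m`), such that for all large `N = n+2`, every positive
translation-invariant periodic ground state `Ψ` (`L = (N/ρ)^{1/3}`) and all `x, z, z'` with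
`ℓ ≤ ‖z − x‖`, `|(z − x)_k| ≤ L/2` (`k = 1,2,3`; nearest-image proviso) and `‖z' − z‖ ≤ ℓ`:
`∫_{cell^{n+1}} |Ψ(x,Y)|² log(|Ψ(z,Y)|/|Ψ(z',Y)|) dY ≤ ω(‖z − x‖) ∫_{cell^{n+1}} |Ψ(x,Y)|² dY`
(`E_{P_x}[log|Ψ(z,·)| − log|Ψ(z',·)|] ≤ ω(‖z − x‖)`; unconditioned the mean increment is `0` by
translation invariance, so `ω` measures how fast the bath forgets the pinned particle; heuristically
`ω(r) = O(ℓ r⁻³)`, the danger is `r⁻¹`). -/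
theorem stub_influenceDecay : open Literature.MathematicalPhysics.QuantumManyBody.BoseGas in ∀ v : ℝ → ENNReal, IsRepulsiveFiniteRange v → (∃ M : NNReal, ∀ r, v r ≤ M) → ∃ ρ₀ : ℝ, 0 < ρ₀ ∧ ∀ ρ : ℝ, 0 < ρ → ρ < ρ₀ → ∃ ℓ : ℝ, 0 < ℓ ∧ ∃ ω : ℝ → ℝ, AntitoneOn ω (Set.Ici ℓ) ∧ ∃ B : ℝ, (∀ m : ℕ, ∑ i ∈ Finset.range m, ω ((i + 2) * ℓ / 2) ≤ B) ∧ ∀ᶠ n : ℕ in Filter.atTop, ∀ Ψ : PeriodicTrialState (n + 2) (sideLength ρ (n + 2)), periodicEnergy v Ψ = periodicGroundStateEnergy v (n + 2) (sideLength ρ (n + 2)) → (∀ X, 0 < (Ψ.ψ X).re ∧ (Ψ.ψ X).im = 0) → (∀ (X : Config (n + 2)) (t : Space), Ψ.ψ (fun i => X i + t) = Ψ.ψ X) → ∀ x z z' : Space, ℓ ≤ ‖z - x‖ → (∀ k : Fin 3, |(z - x) k| ≤ sideLength ρ (n + 2) / 2) → ‖z' - z‖ ≤ ℓ → ∫ Y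 in cellN (n + 1) (sideLength ρ (n + 2)), ‖Ψ.ψ (Matrix.vecCons x Y)‖ ^ 2 * Real.log (‖Ψ.ψ (Matrix.vecCons z Y)‖ / ‖Ψ.ψ (Matrix.vecCons z' Y)‖) ≤ ω ‖z - x‖ * ∫ Y in cellN (n + 1) (sideLength ρ (n + 2)), ‖Ψ.ψ (Matrix.vecCons x Y)‖ ^ 2 := by
  sorry

/-! ### Composition (no `sorry` below this line) -/

section Helpers

variable {n : ℕ} {L : ℝ}

/-- A wave function with positive real part never vanishes: `0 < ‖Ψ X‖`. [folklore] -/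
theorem norm_psi_pos (Ψ : PeriodicTrialState (n + 2) L)
    (hpos : ∀ X, 0 < (Ψ.ψ X).re ∧ (Ψ.ψ X).im = 0) (X : Config (n + 2)) : 0 < ‖Ψ.ψ X‖ := by
  refine norm_pos_iff.2 fun h => ?_
  have := (hpos X).1
  rw [h] at this
  simp at this

/-- Continuity of the slice `Y ↦ ‖Ψ(z, Y)‖`. [folklore] -/
theorem continuous_sliceNorm (Ψ : PeriodicTrialState (n + 2) L) (z : Space) :
    Continuous fun Y : Config (n + 1) => ‖Ψ.ψ (Matrix.vecCons z Y)‖ :=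
  (Ψ.contDiff.continuous.comp
    (continuous_const.finCons continuous_id :
      Continuous fun Y : Config (n + 1) => (Matrix.vecCons z Y : Config (n + 2)))).norm

/-- The Palm-weighted log-ratio increment `‖Ψ(x,Y)‖² log(‖Ψ(z,Y)‖/‖Ψ(z',Y)‖)` of a positive `C¹`
state is continuous in `Y`, hence Bochner-integrable on the (bounded) cell. [folklore] -/
theorem integrableOn_increment (Ψ : PeriodicTrialState (n + 2) L)
    (hpos : ∀ X, 0 < (Ψ.ψ X).re ∧ (Ψ.ψ X).im = 0) (x z z' : Space) :
    IntegrableOn (fun Y : Config (n + 1) => ‖Ψ.ψ (Matrix.vecCons x Y)‖ ^ 2 *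
        Real.log (‖Ψ.ψ (Matrix.vecCons z Y)‖ / ‖Ψ.ψ (Matrix.vecCons z' Y)‖))
      (cellN (n + 1) L) volume := by
  refine integrableOn_cellN ?_ L
  have hz := continuous_sliceNorm Ψ z
  have hz' := continuous_sliceNorm Ψ z'
  have h0 : ∀ Y : Config (n + 1), ‖Ψ.ψ (Matrix.vecCons z' Y)‖ ≠ 0 := fun Y =>
    (norm_psi_pos Ψ hpos _).ne'
  have h1 : ∀ Y : Config (n + 1),
      ‖Ψ.ψ (Matrix.vecCons z Y)‖ / ‖Ψ.ψ (Matrix.vecCons z' Y)‖ ≠ 0 := fun Y =>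
    div_ne_zero (norm_psi_pos Ψ hpos _).ne' (h0 Y)
  exact ((continuous_sliceNorm Ψ x).pow 2).mul ((hz.div hz' h0).log h1)

/-- Translating the tagged particle by a lattice vector: `vecCons (y + Lm) Y = vecCons y Y + L·δ₀m`.
[folklore] -/
theorem vecCons_add_latticeVec (y : Space) (Y : Config (n + 1)) (mv : Fin 3 → ℤ) :
    (Matrix.vecCons (y + latticeVec L mv) Y : Config (n + 2)) =
      (Matrix.vecCons y Y : Config (n + 2)) + latticeVecN L (Pi.single 0 mv) := by
  funext i
  refine Fin.cases ?_ (fun j => ?_) i <;> simp [latticeVecN]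

/-- Periodicity of a periodic trial state in the tagged particle under the whole lattice `Lℤ³`.
[folklore] -/
theorem psi_vecCons_add_latticeVec (Ψ : PeriodicTrialState (n + 2) L) (y : Space)
    (Y : Config (n + 1)) (mv : Fin 3 → ℤ) :
    Ψ.ψ (Matrix.vecCons (y + latticeVec L mv) Y) = Ψ.ψ (Matrix.vecCons y Y) := by
  rw [vecCons_add_latticeVec]
  exact apply_add_latticeVecN_of_periodic Ψ.periodic _ _

/-- Nearest-image reduction: some lattice translate of `y` lies in the closed half-cube centred at
`x` (coordinates rounded to the nearest multiple of `L`). [folklore] -/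
theorem exists_recenter (hL : 0 < L) (x y : Space) :
    ∃ mv : Fin 3 → ℤ, ∀ k : Fin 3, |(y + latticeVec L mv - x) k| ≤ L / 2 := by
  refine ⟨fun k => -round ((y - x) k / L), fun k => ?_⟩
  have h := abs_sub_round ((y - x) k / L)
  have hk : (y + latticeVec L (fun k => -round ((y - x) k / L)) - x) k =
      L * ((y - x) k / L - round ((y - x) k / L)) := by
    rw [mul_sub, mul_div_cancel₀ _ hL.ne']
    simp [latticeVec_apply]
    ring
  rw [hk, abs_mul, abs_of_pos hL]
  calc L * |(y - x) k / L - round ((y - x) k / L)| ≤ L * (1 / 2) := by gcongr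
    _ = L / 2 := by ring

/-- **The chaining estimate.** If the Palm-weighted log-ratio increments of `Ψ` seen from the tagged
position `x` are bounded by `A` in the near field (`‖z - x‖ ≤ ℓ`, steps `≤ ℓ`) and by an antitone
envelope `ω(‖z - x‖)` with bounded partial sums in the far field (inside the half-cube centred at
`x`), then for every `y` in that half-cube the full increment `x → y` is bounded by
`(2 max(A,0) + max(B,0))` times the slice mass: chain `z_i = x + (i/m)(y - x)`, `m = ⌈‖y-x‖/ℓ⌉`,
telescoping of `log`, linearity of the Bochner integral (continuity gives integrability on the
cell), steps `i = 0, 1` near, steps `i ≥ 2` far with `‖z_i - x‖ = i s`, `s ∈ (ℓ/2, ℓ]`. [folklore] -/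
theorem chain_bound {ℓ A B : ℝ} {ω : ℝ → ℝ} (hℓ : 0 < ℓ)
    (hω : AntitoneOn ω (Set.Ici ℓ))
    (hB : ∀ m : ℕ, ∑ i ∈ Finset.range m, ω ((i + 2) * ℓ / 2) ≤ B)
    (Ψ : PeriodicTrialState (n + 2) L) (hpos : ∀ X, 0 < (Ψ.ψ X).re ∧ (Ψ.ψ X).im = 0)
    (x y : Space)
    (hnear : ∀ z z' : Space, ‖z - x‖ ≤ ℓ → ‖z' - z‖ ≤ ℓ →
      ∫ Y in cellN (n + 1) L, ‖Ψ.ψ (Matrix.vecCons x Y)‖ ^ 2 *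
          Real.log (‖Ψ.ψ (Matrix.vecCons z Y)‖ / ‖Ψ.ψ (Matrix.vecCons z' Y)‖) ≤
        A * ∫ Y in cellN (n + 1) L, ‖Ψ.ψ (Matrix.vecCons x Y)‖ ^ 2)
    (hfar : ∀ z z' : Space, ℓ ≤ ‖z - x‖ → (∀ k : Fin 3, |(z - x) k| ≤ L / 2) → ‖z' - z‖ ≤ ℓ →
      ∫ Y in cellN (n + 1) L, ‖Ψ.ψ (Matrix.vecCons x Y)‖ ^ 2 *
          Real.log (‖Ψ.ψ (Matrix.vecCons z Y)‖ / ‖Ψ.ψ (Matrix.vecCons z' Y)‖) ≤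
        ω ‖z - x‖ * ∫ Y in cellN (n + 1) L, ‖Ψ.ψ (Matrix.vecCons x Y)‖ ^ 2)
    (hy : ∀ k : Fin 3, |(y - x) k| ≤ L / 2) :
    ∫ Y in cellN (n + 1) L, ‖Ψ.ψ (Matrix.vecCons x Y)‖ ^ 2 *
        Real.log (‖Ψ.ψ (Matrix.vecCons x Y)‖ / ‖Ψ.ψ (Matrix.vecCons y Y)‖) ≤
      (2 * max A 0 + max B 0) * ∫ Y in cellN (n + 1) L, ‖Ψ.ψ (Matrix.vecCons x Y)‖ ^ 2 := by
  -- the slice mass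
  set M : ℝ := ∫ Y in cellN (n + 1) L, ‖Ψ.ψ (Matrix.vecCons x Y)‖ ^ 2 with hM
  have hM0 : 0 ≤ M := integral_nonneg fun Y => by positivity
  have hA0 : 0 ≤ max A 0 := le_max_right _ _
  have hB0 : 0 ≤ max B 0 := le_max_right _ _
  -- the chain
  set d : Space := y - x with hd
  set m : ℕ := max 1 ⌈‖d‖ / ℓ⌉₊ with hm
  have hm1 : 1 ≤ m := le_max_left _ _
  have hmpos : (0 : ℝ) < m := by exact_mod_cast hm1
  set s : ℝ := ‖d‖ / m with hs
  have hs0 : 0 ≤ s := by positivity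
  set z : ℕ → Space := fun i => x + ((i : ℝ) / m) • d with hz
  have hz0 : z 0 = x := by simp [hz]
  have hzm : z m = y := by
    simp only [hz, div_self hmpos.ne', one_smul, hd]
    abel
  have hzx : ∀ i : ℕ, z i - x = ((i : ℝ) / m) • d := fun i => by simp [hz]
  have hnorm_zx : ∀ i : ℕ, ‖z i - x‖ = i * s := fun i => by
    rw [hzx, norm_smul, Real.norm_eq_abs, abs_of_nonneg (by positivity), hs]
    ring
  have hstep : ∀ i : ℕ, ‖z (i + 1) - z i‖ = s := fun i => by
    have : z (i + 1) - z i = ((1 : ℝ) / m) • d := by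
      simp only [hz, add_sub_add_left_eq_sub, ← sub_smul]
      congr 1
      push_cast
      ring
    rw [this, norm_smul, Real.norm_eq_abs, abs_of_nonneg (by positivity), hs]
    ring
  -- `s ≤ ℓ`
  have hsl : s ≤ ℓ := by
    rw [hs, div_le_iff₀ hmpos]
    have h1 : ‖d‖ / ℓ ≤ ⌈‖d‖ / ℓ⌉₊ := Nat.le_ceil _
    have h2 : (⌈‖d‖ / ℓ⌉₊ : ℝ) ≤ m := by exact_mod_cast le_max_right _ _
    rw [div_le_iff₀ hℓ] at h1
    nlinarith
  -- `ℓ / 2 ≤ s` as soon as there are at least two steps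
  have hs2 : 2 ≤ m → ℓ / 2 ≤ s := fun h2 => by
    have hc2 : 2 ≤ ⌈‖d‖ / ℓ⌉₊ := by
      rcases le_max_iff.1 (hm ▸ h2 : 2 ≤ max 1 ⌈‖d‖ / ℓ⌉₊) with h | h
      · omega
      · exact h
    have hmc : m = ⌈‖d‖ / ℓ⌉₊ := by rw [hm]; exact max_eq_right (by omega)
    have hlt : (⌈‖d‖ / ℓ⌉₊ : ℝ) < ‖d‖ / ℓ + 1 := Nat.ceil_lt_add_one (by positivity)
    have hmR : (2 : ℝ) ≤ m := by exact_mod_cast h2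
    rw [← hmc] at hlt
    have h3 : ((m : ℝ) - 1) * ℓ < ‖d‖ := by
      have := sub_lt_iff_lt_add.2 hlt
      rwa [lt_div_iff₀ hℓ] at this
    rw [hs, le_div_iff₀ hmpos]
    nlinarith
  -- positivity of the slices and pointwise telescoping of the logarithm
  have hpos' : ∀ X, 0 < ‖Ψ.ψ X‖ := norm_psi_pos Ψ hpos
  have htel : ∀ Y : Config (n + 1),
      ‖Ψ.ψ (Matrix.vecCons x Y)‖ ^ 2 *
          Real.log (‖Ψ.ψ (Matrix.vecCons x Y)‖ / ‖Ψ.ψ (Matrix.vecCons y Y)‖) =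
        ∑ i ∈ Finset.range m, ‖Ψ.ψ (Matrix.vecCons x Y)‖ ^ 2 *
          Real.log (‖Ψ.ψ (Matrix.vecCons (z i) Y)‖ / ‖Ψ.ψ (Matrix.vecCons (z (i + 1)) Y)‖) := by
    intro Y
    rw [← Finset.mul_sum]
    congr 1
    have h := Finset.sum_range_sub' (fun i => Real.log ‖Ψ.ψ (Matrix.vecCons (z i) Y)‖) m
    simp only [hz0, hzm] at h
    rw [Real.log_div (hpos' _).ne' (hpos' _).ne', ← h]
    refine Finset.sum_congr rfl fun i _ => ?_
    rw [Real.log_div (hpos' _).ne' (hpos' _).ne']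
  have hint : ∀ i : ℕ, IntegrableOn (fun Y : Config (n + 1) => ‖Ψ.ψ (Matrix.vecCons x Y)‖ ^ 2 *
      Real.log (‖Ψ.ψ (Matrix.vecCons (z i) Y)‖ / ‖Ψ.ψ (Matrix.vecCons (z (i + 1)) Y)‖))
        (cellN (n + 1) L) volume := fun i =>
    integrableOn_increment Ψ hpos x (z i) (z (i + 1))
  have hsplit : (∫ Y in cellN (n + 1) L, ‖Ψ.ψ (Matrix.vecCons x Y)‖ ^ 2 *
        Real.log (‖Ψ.ψ (Matrix.vecCons x Y)‖ / ‖Ψ.ψ (Matrix.vecCons y Y)‖)) =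
      ∑ i ∈ Finset.range m, ∫ Y in cellN (n + 1) L, ‖Ψ.ψ (Matrix.vecCons x Y)‖ ^ 2 *
        Real.log (‖Ψ.ψ (Matrix.vecCons (z i) Y)‖ / ‖Ψ.ψ (Matrix.vecCons (z (i + 1)) Y)‖) := by
    rw [← integral_finsetSum _ fun i _ => hint i]
    exact integral_congr_ae (Filter.Eventually.of_forall htel)
  -- per-step bounds
  have hTi : ∀ i : ℕ, i < m →
      ∫ Y in cellN (n + 1) L, ‖Ψ.ψ (Matrix.vecCons x Y)‖ ^ 2 *
          Real.log (‖Ψ.ψ (Matrix.vecCons (z i) Y)‖ / ‖Ψ.ψ (Matrix.vecCons (z (i + 1)) Y)‖) ≤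
        (if i < 2 then max A 0 else ω (i * ℓ / 2)) * M := by
    intro i him
    by_cases hi2 : i < 2
    · rw [if_pos hi2]
      have hi1 : (i : ℝ) ≤ 1 := by exact_mod_cast Nat.lt_succ_iff.1 hi2
      have h := hnear (z i) (z (i + 1)) (by rw [hnorm_zx]; nlinarith) (by rw [hstep]; exact hsl)
      exact h.trans (mul_le_mul_of_nonneg_right (le_max_left _ _) hM0)
    · rw [if_neg hi2]
      push Not at hi2
      have hiR : (2 : ℝ) ≤ i := by exact_mod_cast hi2
      have hs2' : ℓ / 2 ≤ s := hs2 (by omega)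
      have hℓi : ℓ ≤ i * s := by nlinarith
      have him' : (i : ℝ) / m ≤ 1 := by
        rw [div_le_one hmpos]
        exact_mod_cast him.le
      have hcube : ∀ k : Fin 3, |(z i - x) k| ≤ L / 2 := fun k => by
        rw [hzx]
        simp only [PiLp.smul_apply, smul_eq_mul, abs_mul]
        rw [abs_of_nonneg (by positivity)]
        exact (mul_le_of_le_one_left (abs_nonneg _) him').trans (hy k)
      have h := hfar (z i) (z (i + 1)) (by rw [hnorm_zx]; exact hℓi) hcube
        (by rw [hstep]; exact hsl)
      refine h.trans (mul_le_mul_of_nonneg_right ?_ hM0)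
      rw [hnorm_zx]
      exact hω (Set.mem_Ici.2 (by nlinarith)) (Set.mem_Ici.2 hℓi) (by nlinarith)
  -- summing the envelope
  have hbsum : ∑ i ∈ Finset.range m, (if i < 2 then max A 0 else ω (i * ℓ / 2)) ≤
      2 * max A 0 + max B 0 := by
    rcases Nat.lt_or_ge m 2 with hm2 | hm2
    · have hm1' : m = 1 := by omega
      rw [hm1', Finset.sum_range_one, if_pos (by norm_num)]
      linarith
    · rw [← Finset.sum_range_add_sum_Ico _ hm2, Finset.sum_Ico_eq_sum_range]
      have h01 : ∑ i ∈ Finset.range 2, (if i < 2 then max A 0 else ω (i * ℓ / 2)) = 2 * max A 0 := by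
        norm_num [Finset.sum_range_succ]
        ring
      have h2 : ∀ k : ℕ, (if 2 + k < 2 then max A 0 else ω ((((2 + k : ℕ) : ℝ)) * ℓ / 2)) =
          ω ((k + 2) * ℓ / 2) := fun k => by
        rw [if_neg (by omega)]
        congr 1
        push_cast
        ring
      rw [h01]
      simp only [h2]
      have := hB (m - 2)
      nlinarith [le_max_left B 0]
  -- assemble
  rw [hsplit]
  calc ∑ i ∈ Finset.range m, ∫ Y in cellN (n + 1) L, ‖Ψ.ψ (Matrix.vecCons x Y)‖ ^ 2 *
          Real.log (‖Ψ.ψ (Matrix.vecCons (z i) Y)‖ / ‖Ψ.ψ (Matrix.vecCons (z (i + 1)) Y)‖)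
        ≤ ∑ i ∈ Finset.range m, (if i < 2 then max A 0 else ω (i * ℓ / 2)) * M :=
          Finset.sum_le_sum fun i hi => hTi i (Finset.mem_range.1 hi)
    _ = (∑ i ∈ Finset.range m, (if i < 2 then max A 0 else ω (i * ℓ / 2))) * M := by
          rw [Finset.sum_mul]
    _ ≤ (2 * max A 0 + max B 0) * M := mul_le_mul_of_nonneg_right hbsum hM0

end Helpers

/-- **The two stubs imply the crux `NonPairwisePalmMean` BY NAME**, through its bare-landscape
instance `u := 0` (`U₀ := 0`): `ρ₀ := min ρ₀ⁿᵉᵃʳ ρ₀ᶠᵃʳ`; the far stub supplies the scale `ℓ`, the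
envelope `ω` and `B`, the near stub the constant `A` at that `ℓ`; `C := 2 max(A,0) + max(B,0)`;
eventually in `n` both stubs hold; for a ground state `Ψ` and `x, y` reduce `y` to its nearest
lattice image `y'` in the half-cube centred at `x` (`exists_recenter`, periodicity of `Ψ` in the
tagged particle, `psi_vecCons_add_latticeVec`) and apply the chaining estimate `chain_bound`.
[folklore] -/
theorem NonPairwisePalmMean_of :
    Goal.stub_palmLogHarnack → Goal.stub_influenceDecay →
    Summit.AtomisticToContinuum.BoseEinsteinCondensation.Theses.BECLiebAntibunching.NonPairwisePalmMean := by
  intro hNear hFar v hv hM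
  obtain ⟨ρ₁, hρ₁, H1⟩ := hNear v hv hM
  obtain ⟨ρ₂, hρ₂, H2⟩ := hFar v hv hM
  refine ⟨min ρ₁ ρ₂, lt_min hρ₁ hρ₂, fun ρ hρ hρlt => ?_⟩
  obtain ⟨ℓ, hℓ, ω, hω, B, hB, H2⟩ := H2 ρ hρ (lt_of_lt_of_le hρlt (min_le_right _ _))
  obtain ⟨A, H1⟩ := H1 ρ hρ (lt_of_lt_of_le hρlt (min_le_left _ _)) ℓ hℓ
  refine ⟨0, 2 * max A 0 + max B 0, ?_⟩
  filter_upwards [H1, H2] with n hn1 hn2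
  refine ⟨fun _ => 0, continuous_const, fun z => by simp, fun z => rfl, fun z k => rfl, ?_⟩
  intro Ψ hE hpos hTI x y
  simp only [sub_self, Finset.sum_const_zero, sub_zero]
  have hL : 0 < sideLength ρ (n + 2) := sideLength_pos_of_pos hρ (by omega)
  obtain ⟨mv, hmv⟩ := exists_recenter hL x y
  have key := chain_bound hℓ hω hB Ψ hpos x (y + latticeVec (sideLength ρ (n + 2)) mv)
    (hn1 Ψ hE hpos hTI x) (hn2 Ψ hE hpos hTI x) hmv
  simpa only [psi_vecCons_add_latticeVec] using key

/-- The skeleton as a proof of the crux THROUGH the sorried stubs (it also type-checks that the stub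
signatures are the `Goal` statements verbatim).  Becomes a proof of stmt-AtomisticToContinuum-10240
once the two stubs land sorry-free. [folklore] -/
theorem NonPairwisePalmMean_of_stubs :
    Summit.AtomisticToContinuum.BoseEinsteinCondensation.Theses.BECLiebAntibunching.NonPairwisePalmMean :=
  NonPairwisePalmMean_of stub_palmLogHarnack stub_influenceDecay

end Summit.AtomisticToContinuum.BoseEinsteinCondensation.Cruxes.NonPairwisePalmMean.Birth
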